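import Mathlib
import Literature.AlgebraicGeometry.Resolution.TranscendenceDefect
import Literature.AlgebraicGeometry.Resolution.LocalBlowup
import HarnessLib

/-!
# AbhyankarMonomialUniformization

Topic `Literature/AlgebraicGeometry/Resolution`. Named literature fact(s) relocated by the gate from `Summits/ResolutionOfSingularities/ResolutionOfSingularities/Theorems/RadicialJungCleanModelsAbhyankarKK05.lean`
(accept-time relocation of `[cite]`d propositions written inline in a Summits proposal; human ruling 2026-08-15).
Sources: KnafKuhlmann2005.

* `Literature.AlgebraicGeometry.Resolution.`
-/

namespace Literature.AlgebraicGeometry.Resolution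

open IsLocalRing AlgebraicGeometry CategoryTheory
open Literature.AlgebraicGeometry.Resolution

/-- NAMED FACT — **Knaf–Kuhlmann 2005, Thm. 1.1 with its monomiality clause, for places with algebraic residue field extension.**
"Let `P` be a `K`-trivial Abhyankar place of the function field `F|K`, and assume that `FP|K` is separable. Take a finite set `Z ⊂ 𝒪_P`.
Then the pair `(P, Z)` is `K`-uniformizable on a variety `X` such that `P` is centered in a smooth point `x ∈ X` and
`dim 𝒪_{X,x} = dim_ℚ(v_P F ⊗ ℚ)`.  Moreover, `X` can be chosen such that all `ζ ∈ Z` are `𝒪_{X,x}`-monomials in `{a₁,…,a_d}` for some regular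
parameter system `(a₁,…,a_d)` of `𝒪_{X,x}`" (an `𝒪`-monomial in `H`: `a = u ∏ hᵢ^{μᵢ}`, `u ∈ 𝒪^×`, `μᵢ ∈ ℕ₀`, p. 2; `(P, Z)` `K`-uniformizable on
`X`: `X` an integral separated `K`-scheme of finite type with function field `F`, `P` centred in a regular point `x`, `Z ⊆ 𝒪_{X,x}`, p. 3).
Rendering: `F|K` ↦ a finitely generated field extension `K/k` (`(⊤ : IntermediateField k K).FG`); `P` ↦ a valuation ring `O` of `K` containing
`k`; Abhyankar ↦ `transcendenceDefect k O hk = 0` (`TranscendenceDefect.lean`); SPECIAL CASE `FP|K` algebraic, where "separable" is separable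
algebraic (`Algebra.IsSeparable` for `k → O → κ(O)`); the variety ↦ an affine neighbourhood `Spec A'` of `x` on which the elements of `Z` are
regular functions (`A'` a finitely generated `k`-subalgebra of `K` inside `O` with fraction field `K` and `Z ⊆ A'`); `𝒪_{X,x}` ↦
`locAtCentre A' O`; "smooth point" WEAKENED to "regular"; the dimension clause DROPPED.  The tree's `KnafKuhlmann2005_Thm11`
(`FiniteExtensionUniformization.lean`, ambient-field vocabulary, PROVED) is this theorem WITHOUT the monomiality clause.
-- TODO(general form): `FP|K` separably generated of positive transcendence degree; `x` smooth over `K`; `dim 𝒪_{X,x} = rr(v_P F)`.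
[cite: KnafKuhlmann2005, Thm. 1.1] [file AlgebraicGeometry/Resolution/AbhyankarMonomialUniformization] -/
def KnafKuhlmann2005_Thm11_monomial.{u} : Prop :=
  ∀ (k K : Type u) [Field k] [Field K] [Algebra k K], (⊤ : IntermediateField k K).FG →
    ∀ (O : ValuationSubring K) (hk : ∀ c : k, algebraMap k K c ∈ O),
      Literature.AlgebraicGeometry.Resolution.transcendenceDefect k O hk = 0 →
      @Algebra.IsSeparable k (IsLocalRing.ResidueField O) _ _
        ((IsLocalRing.residue O).comp ((algebraMap k K).codRestrict O hk)).toAlgebra →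
      ∀ Z : Finset K, (∀ z ∈ Z, z ∈ O) →
        ∃ (A' : Subalgebra k K), A'.FG ∧ A'.toSubring ≤ O.toSubring ∧ IsFractionRing A' K ∧ (∀ z ∈ Z, z ∈ A') ∧
          ∃ (_ : IsRegularLocalRing (Literature.AlgebraicGeometry.Resolution.locAtCentre A'.toSubring O)) (d : ℕ) (a : Fin d → Literature.AlgebraicGeometry.Resolution.locAtCentre A'.toSubring O),
            Ideal.span (Set.range a) = IsLocalRing.maximalIdeal (Literature.AlgebraicGeometry.Resolution.locAtCentre A'.toSubring O) ∧
            ringKrullDim (Literature.AlgebraicGeometry.Resolution.locAtCentre A'.toSubring O) = d ∧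
            ∀ z ∈ Z, ∃ (v : Literature.AlgebraicGeometry.Resolution.locAtCentre A'.toSubring O) (μ : Fin d → ℕ), IsUnit v ∧
              z = (v : K) * ∏ i, ((a i : Literature.AlgebraicGeometry.Resolution.locAtCentre A'.toSubring O) : K) ^ (μ i)

end Literature.AlgebraicGeometry.Resolution

/-! ## Relocated from `Summits/ResolutionOfSingularities/ResolutionOfSingularities/Theorems/RadicialJungCleanModelsAbhyankarKnafKuhlmann.lean` (gate, accept-time relocation of cited facts) — KnafKuhlmann2005 -/

namespace Literature.AlgebraicGeometry.Resolution

open IsLocalRing AlgebraicGeometry CategoryTheory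
open Literature.AlgebraicGeometry.Resolution

/-- NAMED FACT — **Knaf–Kuhlmann 2005, Thm. 1.1 with its monomiality clause, for places with algebraic residue field extension**
(CORRECTED typing: the monomial form is asked for the NON-ZERO elements of `Z` only).
"Let `P` be a `K`-trivial Abhyankar place of the function field `F|K`, and assume that `FP|K` is separable. Take a finite set `Z ⊂ 𝒪_P`.
Then the pair `(P, Z)` is `K`-uniformizable on a variety `X` such that `P` is centered in a smooth point `x ∈ X` and
`dim 𝒪_{X,x} = dim_ℚ(v_P F ⊗ ℚ)`.  Moreover, `X` can be chosen such that all `ζ ∈ Z` are `𝒪_{X,x}`-monomials in `{a₁,…,a_d}` for some regular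
parameter system `(a₁,…,a_d)` of `𝒪_{X,x}`" (an `𝒪`-monomial in `H`: `a = u ∏ hᵢ^{μᵢ}`, `u ∈ 𝒪^×`, `μᵢ ∈ ℕ₀`, p. 2 — necessarily `a ≠ 0` in a
domain, so the clause concerns `ζ ≠ 0`; `(P, Z)` `K`-uniformizable on `X`: `X` an integral separated `K`-scheme of finite type with function
field `F`, `P` centred in a regular point `x`, `Z ⊆ 𝒪_{X,x}`, p. 3).  Rendering: `F|K` ↦ a finitely generated field extension `K/k`
(`(⊤ : IntermediateField k K).FG`); `P` ↦ a valuation ring `O` of `K` containing `k`; Abhyankar ↦ `transcendenceDefect k O hk = 0`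
(`TranscendenceDefect.lean`); SPECIAL CASE `FP|K` algebraic, where "separable" is separable algebraic (`Algebra.IsSeparable` for
`k → O → κ(O)`); the variety ↦ an affine neighbourhood `Spec A'` of `x` on which the elements of `Z` are regular functions (`A'` a finitely
generated `k`-subalgebra of `K` inside `O` with fraction field `K` and `Z ⊆ A'`); `𝒪_{X,x}` ↦ `locAtCentre A' O`; "smooth point" WEAKENED to
"regular"; the dimension clause DROPPED.  The tree's `KnafKuhlmann2005_Thm11` (`FiniteExtensionUniformization.lean`, ambient-field vocabulary,
PROVED) is this theorem WITHOUT the monomiality clause; `KnafKuhlmann2005_Thm11_monomial` (same file as this fact) is the UNGUARDED typing,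
false as typed (`ζ = 0`).
-- TODO(general form): `FP|K` separably generated of positive transcendence degree; `x` smooth over `K`; `dim 𝒪_{X,x} = rr(v_P F)`.
[cite: KnafKuhlmann2005, Thm. 1.1] [file AlgebraicGeometry/Resolution/AbhyankarMonomialUniformization] -/
def KnafKuhlmann2005_Thm11_monomialForm : Prop :=
  ∀ (k K : Type*) [Field k] [Field K] [Algebra k K], (⊤ : IntermediateField k K).FG →
    ∀ (O : ValuationSubring K) (hk : ∀ c : k, algebraMap k K c ∈ O),
      Literature.AlgebraicGeometry.Resolution.transcendenceDefect k O hk = 0 →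
      @Algebra.IsSeparable k (IsLocalRing.ResidueField O) _ _
        ((IsLocalRing.residue O).comp ((algebraMap k K).codRestrict O hk)).toAlgebra →
      ∀ Z : Finset K, (∀ z ∈ Z, z ∈ O) →
        ∃ (A' : Subalgebra k K), A'.FG ∧ A'.toSubring ≤ O.toSubring ∧ IsFractionRing A' K ∧ (∀ z ∈ Z, z ∈ A') ∧
          ∃ (_ : IsRegularLocalRing (Literature.AlgebraicGeometry.Resolution.locAtCentre A'.toSubring O)) (d : ℕ)
            (a : Fin d → Literature.AlgebraicGeometry.Resolution.locAtCentre A'.toSubring O),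
            Ideal.span (Set.range a) = IsLocalRing.maximalIdeal (Literature.AlgebraicGeometry.Resolution.locAtCentre A'.toSubring O) ∧
            ringKrullDim (Literature.AlgebraicGeometry.Resolution.locAtCentre A'.toSubring O) = d ∧
            ∀ z ∈ Z, z ≠ 0 → ∃ (v : Literature.AlgebraicGeometry.Resolution.locAtCentre A'.toSubring O) (μ : Fin d → ℕ), IsUnit v ∧
              z = (v : K) * ∏ i, ((a i : Literature.AlgebraicGeometry.Resolution.locAtCentre A'.toSubring O) : K) ^ (μ i)

end Literature.AlgebraicGeometry.Resolution

/-! ## Relocated from `Summits/ResolutionOfSingularities/ResolutionOfSingularities/Theorems/RadicialJungCleanModelsLocalMonomializationGroundFieldDescent.lean` (gate, accept-time relocation of cited facts) — KnafKuhlmann2005 -/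

namespace Literature.AlgebraicGeometry.Resolution

open IsLocalRing AlgebraicGeometry CategoryTheory
open Literature.AlgebraicGeometry.Resolution

/-- NAMED FACT — **Knaf–Kuhlmann 2005, Thm. 1.1 with its monomiality clause, GENERAL form (separably generated residue field extension).**
"Let `P` be a `K`-trivial Abhyankar place of the function field `F|K`, and assume that `FP|K` is separable. Take a finite set `Z ⊂ 𝒪_P`.
Then the pair `(P, Z)` is `K`-uniformizable on a variety `X` such that `P` is centered in a smooth point `x ∈ X` and
`dim 𝒪_{X,x} = dim_ℚ(v_P F ⊗ ℚ)`.  Moreover, `X` can be chosen such that all `ζ ∈ Z` are `𝒪_{X,x}`-monomials in `{a₁,…,a_d}` for some regular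
parameter system `(a₁,…,a_d)` of `𝒪_{X,x}`" (an `𝒪`-monomial in `H`: `a = u ∏ hᵢ^{μᵢ}`, `u ∈ 𝒪^×`, `μᵢ ∈ ℕ₀`, p. 2 — so the clause concerns
`ζ ≠ 0`; `(P, Z)` `K`-uniformizable on `X`: `X` an integral separated `K`-scheme of finite type with function field `F`, `P` centred in a regular
point `x`, `Z ⊆ 𝒪_{X,x}`, p. 3; "`FP|K` separable" for the finitely generated extension `FP|K` (Cor. 2.2) = separably generated).  Rendering: as
`KnafKuhlmann2005_Thm11_monomialForm` (same file after relocation) — `F|K` ↦ a finitely generated `K/k`, `P` ↦ a valuation ring `O ⊇ k` of `K`,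
Abhyankar ↦ `transcendenceDefect k O hk = 0`, the variety ↦ an affine neighbourhood `Spec A'` of `x` with `Z ⊆ A'` (shrink `X`), `𝒪_{X,x}` ↦
`locAtCentre A' O`, "smooth" WEAKENED to "regular", dimension clause DROPPED — EXCEPT that «`FP|K` separable» is now rendered in general: a finite
separating transcendence basis of `κ(O)` over `k` (`IsTranscendenceBasis` + `Algebra.IsSeparable` over the field it generates; the shape of Mathlib's
`exists_isTranscendenceBasis_and_isSeparable_of_perfectField`), for the structure `k → O → κ(O)`.  The special case `…_monomialForm` (separable
ALGEBRAIC residue field extension) is the case of the empty basis.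
[cite: KnafKuhlmann2005, Thm. 1.1] [file AlgebraicGeometry/Resolution/AbhyankarMonomialUniformization] -/
def KnafKuhlmann2005_Thm11_monomialFormSepGen : Prop :=
  ∀ (k K : Type*) [Field k] [Field K] [Algebra k K], (⊤ : IntermediateField k K).FG →
    ∀ (O : ValuationSubring K) (hk : ∀ c : k, algebraMap k K c ∈ O),
      Literature.AlgebraicGeometry.Resolution.transcendenceDefect k O hk = 0 →
      (letI : Algebra k (IsLocalRing.ResidueField O) :=
          ((IsLocalRing.residue O).comp ((algebraMap k K).codRestrict O hk)).toAlgebra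
        ∃ s : Finset (IsLocalRing.ResidueField O),
          IsTranscendenceBasis k ((↑) : s → IsLocalRing.ResidueField O) ∧
          Algebra.IsSeparable (IntermediateField.adjoin k (s : Set (IsLocalRing.ResidueField O))) (IsLocalRing.ResidueField O)) →
      ∀ Z : Finset K, (∀ z ∈ Z, z ∈ O) →
        ∃ (A' : Subalgebra k K), A'.FG ∧ A'.toSubring ≤ O.toSubring ∧ IsFractionRing A' K ∧ (∀ z ∈ Z, z ∈ A') ∧
          ∃ (_ : IsRegularLocalRing (Literature.AlgebraicGeometry.Resolution.locAtCentre A'.toSubring O)) (d : ℕ)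
            (a : Fin d → Literature.AlgebraicGeometry.Resolution.locAtCentre A'.toSubring O),
            Ideal.span (Set.range a) = IsLocalRing.maximalIdeal (Literature.AlgebraicGeometry.Resolution.locAtCentre A'.toSubring O) ∧
            ringKrullDim (Literature.AlgebraicGeometry.Resolution.locAtCentre A'.toSubring O) = d ∧
            ∀ z ∈ Z, z ≠ 0 → ∃ (v : Literature.AlgebraicGeometry.Resolution.locAtCentre A'.toSubring O) (μ : Fin d → ℕ), IsUnit v ∧
              z = (v : K) * ∏ i, ((a i : Literature.AlgebraicGeometry.Resolution.locAtCentre A'.toSubring O) : K) ^ (μ i)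

end Literature.AlgebraicGeometry.Resolution
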